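import Summits.QuantumFields.BalabanUV.Beta.NVertexParities
import Summits.QuantumFields.BalabanUV.Beta.FP.TorusCompositeObjects

/-!
# `BalabanUV.Beta.FP.TowerNParityRows` — road «FP» for binder row D1, ROUTE T (β1): **FIVE DISPLAYED (S3-2) N ROWS OF THE END WRAPPER — `hVNm`, `hVNt`,
# `hVN`, `hWN`, `hδN` — AS THEOREMS IN THE WRAPPER's EXACT SHAPES, FROM an2 g61's PART 12 `NVertexParities`** (the instantiation «at the wrapper is the road's»,
# an2 LANDED-1 l.67194 ∕ INTENT-3)

WHY.  The END wrapper `StepRecursionFeedNestedNamedB.d1Tel_JcComp_ctr_named` (p405971 ✓) DISPLAYS, among the N system's (S3-2) rows, the first-order parities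
`hVNm : ∀ n μ y B a a′, (perF T (dper T (VN (Roots.ctr Lc) Pn (n+1) μ y))) (fN n B a) (fN n B a′) = 0` and `hVNt : … (b.1, inl b.2) (fN n B a) = … (fN n B a) (b.1, inl b.2)`
(`T := towerTorus Lc (fine Lc (Mc B)) (n+1)`; the N leg `fN n B` lands in multiplier fibres: `hmN : ∀ n B a, ∃ m, (fN n B a).2 = inr m`, l.261), and the family letters
`hVN : ∀ n, VertexFamily (VN (Roots.ctr Lc) Pn (n+1)) (NN n) (CvN n) (δN n)`, `hWN : ∀ n, VertexFamily₂ (WN …) (NN n) (CwN n) (δN n)`, `hδN : ∀ n, 0 < δN n` (l.276–279).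
an2 g61's PART 12 (`NVertexParities`, ✓ 20:56Z) proves them IN SHAPE for every box `M`, every `R P j`, every leg `f` into multiplier fibres
(`perF_dper_VN_apply_of_inr_inr`, `perF_dper_VN_inl_apply_of_inr`, `vertexFamilies_VN_WN`).  THIS FILE is the road's instantiation: the five rows as theorems whose
types are the wrapper's binder types ON THE NOSE (`R := Roots.ctr Lc`, `P := Pn`, `M := Mc B`, depth `j := n+1`, `T := towerTorus Lc (fine Lc (Mc B)) (n+1)`,
quantifier prefixes `∀ n μ y, ∀ B, ∀ …` as displayed), so that the next wrapper version replaces `hVNm := hVNm_rows Mc Pn fN hmN`, `hVNt := hVNt_rows …`, and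
obtains `NN CvN CwN δN hVN hWN hδN` from `exists_NN_rows` (`NN n = Lc^(n+2)`) — five displayed rows become two data binders (`fN`, `hmN`) already present.

WHAT ([folklore] instantiation BY NAME; no `def`, no `def … : Prop`, nothing cited, 0 sorry): `hVNm_rows`, `hVNt_rows` (from PART 12 §Binders at `f := fN n B`, `hf := hmN n B`),
`exists_NN_rows` (from `vertexFamilies_VN_WN` by `choose` over `n`; the blocking of record `NN n := Lc^(n+2)`).
WHAT THIS IS NOT: not a new wrapper version (the replacement is the successor's edit at the call site), not the second-order parities `hWNm ∕ hWNt` (blocks of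
`WN = WchartOf … 0` — an2's successor item), not `hHN₁ ∕ hQN₁ ∕ hHN₂ ∕ hQN₂` (the junctions); no estimate; nothing of Bałaban's asserted, valued or discharged — the rows
are parities ∕ localisation letters of an2's OWN typed objects; 0∕4 row-D1 binders (hW, hR, D1Tel, D1Rep); ROOT M‴ p325680 untouched; NOT (C1), NOT (L2′), NOT (T-ID),
NOT SDF, NOT D1, NOT BetaPertH, NOT continuum, NOT Clay.

HONEST DEPENDENCY (page 1, mandatory): continuum YM on T⁴ ⇐ BetaPertH ∧ nine spine estimates (0/9 proved); BetaPertH ⇐ (D1) ∧ (D4) ∧ CAP+tail;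
G-an2-4 gates asym, D1 and NE2/3/4.  HONEST FRAMING (cell contract, verbatim): «discharging `BetaPertH` makes Bałaban's UV stability UNCONDITIONAL —
a real constructive-QFT result; it is NOT the continuum limit and NOT the Clay problem.»  ABSOLUTE RULE (cell charter, verbatim): «No internally-minted
statement may enter as a cited fact. Every hypothesis is either kernel-proved in this package or a verbatim quotation of a PUBLISHED theorem with page
reference. The manuscript(s) under audit are NOT citable for their own disputed steps — they are the thing under adjudication; programme-internal
(2001/route/tribunal) claims are never citable.»  Road «FP» OWNER, b2b-balaban-beta-d1-p3 gen 38, 2026-08-26.  No existing file touched.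
-/

noncomputable section

namespace Summit.QuantumFields.BalabanUV.Beta.FP.TowerNParityRows

open Literature.MathematicalPhysics.QuantumFieldTheory.Balaban1983to89 Literature.MathematicalPhysics.QuantumFieldTheory.Balaban1983to89.Beta
open B5Prop11Plancherel (fine)  open B6Lemma24Torus (pbox)
open AffineAveraging (Site)  open ExpKernelCalculus (VertexFamily VertexFamily₂)  open OneStepResolventKernel (Fib)
open Summit.QuantumFields.BalabanUV.Beta.CompositeOneShotJetData (Roots Pins VN WN)
open Summit.QuantumFields.BalabanUV.Beta.NVertexParities (perF_dper_VN_apply_of_inr_inr perF_dper_VN_inl_apply_of_inr vertexFamilies_VN_WN)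
open Summit.QuantumFields.BalabanUV.Beta.FP.KernelPeriodisationFib (Idx perF)
open Summit.QuantumFields.BalabanUV.Beta.FP.KernelPeriodisationFibLoc (dper)
open Summit.QuantumFields.BalabanUV.Beta.FP.TorusCompositeObjects (towerTorus)

variable {Lc : ℕ} [NeZero Lc] (Mc : ℕ → (Fin (3 + 1) → ℕ)) (Pn : Pins)
  (fN : ∀ n : ℕ, ∀ B : ℕ, (↥(pbox (Mc B)) × Fin (3 + 1)) → Idx (towerTorus Lc (fine Lc (Mc B)) (n + 1)) (Fib 3))
  (hmN : ∀ n : ℕ, ∀ B : ℕ, ∀ a : (↥(pbox (Mc B)) × Fin (3 + 1)), ∃ m : Fin (3 + 1), ((fN n) B a).2 = Sum.inr m)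
include hmN

/-- [folklore] **`hVNm_rows` — THE WRAPPER's `hVNm` ROW**: on two N-leg indices (multiplier fibres, `hmN`) the periodised N-vertex vanishes, at every depth, label and box
(an2 PART 12 `perF_dper_VN_apply_of_inr_inr`). -/
theorem hVNm_rows : ∀ (n : ℕ) (μ : Fin (3 + 1)) (y : Fin (3 + 1) → ℤ), ∀ B : ℕ, ∀ a a' : (↥(pbox (Mc B)) × Fin (3 + 1)),
    (perF (towerTorus Lc (fine Lc (Mc B)) (n + 1)) (dper (towerTorus Lc (fine Lc (Mc B)) (n + 1)) ((VN (Roots.ctr Lc) Pn (n + 1)) μ y)))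
      (((fN n) B) a) (((fN n) B) a') = 0 :=
  fun n μ y B a a' => perF_dper_VN_apply_of_inr_inr (Roots.ctr Lc) Pn (n + 1) (towerTorus Lc (fine Lc (Mc B)) (n + 1)) ((fN n) B) ((hmN n) B) μ y a a'

/-- [folklore] **`hVNt_rows` — THE WRAPPER's `hVNt` ROW**: a field index against an N-leg index reads the same both ways (an2 PART 12 `perF_dper_VN_inl_apply_of_inr`). -/
theorem hVNt_rows : ∀ (n : ℕ) (μ : Fin (3 + 1)) (y : Fin (3 + 1) → ℤ), ∀ B : ℕ,
    ∀ (b : (↥(pbox (towerTorus Lc (fine Lc (Mc B)) (n + 1))) × Fin (3 + 1))) (a : (↥(pbox (Mc B)) × Fin (3 + 1))),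
    (perF (towerTorus Lc (fine Lc (Mc B)) (n + 1)) (dper (towerTorus Lc (fine Lc (Mc B)) (n + 1)) ((VN (Roots.ctr Lc) Pn (n + 1)) μ y))) (b.1, Sum.inl b.2) (((fN n) B) a)
      = (perF (towerTorus Lc (fine Lc (Mc B)) (n + 1)) (dper (towerTorus Lc (fine Lc (Mc B)) (n + 1)) ((VN (Roots.ctr Lc) Pn (n + 1)) μ y))) (((fN n) B) a) (b.1, Sum.inl b.2) :=
  fun n μ y B b a => perF_dper_VN_inl_apply_of_inr (Roots.ctr Lc) Pn (n + 1) (towerTorus Lc (fine Lc (Mc B)) (n + 1)) ((fN n) B) ((hmN n) B) μ y b a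

omit hmN in
/-- [folklore] **`exists_NN_rows` — THE WRAPPER's `hVN ∕ hWN ∕ hδN` ROWS**: depth-indexed blockings, constants and ONE positive rate per depth with
`VertexFamily (VN (Roots.ctr Lc) Pn (n+1)) (NN n) (CvN n) (δN n)`, `VertexFamily₂ (WN …) (NN n) (CwN n) (δN n)`, `0 < δN n`, and `NN n = Lc^(n+2)` — an2 PART 12
`vertexFamilies_VN_WN`, chosen along `n`. -/
theorem exists_NN_rows : ∃ (NN : ℕ → ℕ) (CvN CwN δN : ℕ → ℝ),
    (∀ n : ℕ, VertexFamily (VN (Roots.ctr Lc) Pn (n + 1)) (NN n) (CvN n) (δN n))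
      ∧ (∀ n : ℕ, VertexFamily₂ (WN (Roots.ctr Lc) Pn (n + 1)) (NN n) (CwN n) (δN n))
      ∧ (∀ n : ℕ, 0 < δN n) ∧ (∀ n : ℕ, NN n = Lc ^ (n + 1 + 1)) := by
  choose Cv Cw δ hδ hV hW using fun n : ℕ => vertexFamilies_VN_WN (Roots.ctr Lc) Pn (n + 1)
  exact ⟨fun n => Lc ^ (n + 1 + 1), Cv, Cw, δ, hV, hW, hδ, fun _ => rfl⟩

end Summit.QuantumFields.BalabanUV.Beta.FP.TowerNParityRows

end
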